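import Summits.KontsevichZagierPeriods.KontsevichZagierPeriods.Theorems.TerasomaMultiplicationBetaCancellationStubMoebiusMove
import Summits.KontsevichZagierPeriods.KontsevichZagierPeriods.Theorems.HurwitzMicroSectorsNormalFormPrincipleAlgDlogMoves

/-!
# `NormalFormPrinciple` (stmt-KontsevichZagierPeriods-3869), line `SketchIdeator1` —
# registered sub-goal `angA_rotate_mem_relations` (arctangent layer of `stub_boxRigidity`)

Siege attempt k3 (variation "reduce to landed lemmas, then assemble") for the registered stub
`angA_rotate_mem_relations` of the crux `NormalFormPrinciple` (route HurwitzMicroSectors): for real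
algebraic `a ≤ b`, `σ` with `1 − σy > 0` on `[a, b]`, the two arctangent representations
`[(a, b), d/(1+y²)]` and `[(Φ a, Φ b), d/(1+y²)]`, `Φ(y) = (y + σ)/(1 − σy)` (the rotation of the
circle `y = tan θ` by `arctan σ`), differ by a relation of the Kontsevich–Zagier calculus.

The proof is ONE change-of-variables move (rule (2), `KZ.changeOfVariablesRel`), ASSEMBLED from the
landed Möbius-rotation lemmas of
`Theorems/TerasomaMultiplicationBetaCancellationStubMoebiusMove.lean`
(`BetaCancellationLine.moeb_image`, `moeb_isSemialgebraicMapOn`, `moeb_hasFDerivAt`, `moeb_injOn`,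
`moeb_abs_det`, `moeb_pullback`) for the normalised rotation `M(t) = (ct − s)/(st + c)`,
`c² + s² = 1`: here `c = 1/r`, `s = −σ/r`, `r = √(1 + σ²)` (real algebraic with `σ`), for which
`M(t) = (t + σ)/(1 − σt) = Φ(t)` and `st + c = (1 − σt)/r > 0` on `[a, b]` — the same reduction as
`InverseLandau.an_rotate` (`…InverseLandauTateFamilyKernelCurvesStubArcNormalization.lean`). The
landed packaged move `BetaCancellationLine.stub_moebiusMove` is not called as is, because it asks for
an algebraic constant `κ`, while the registered signature carries no hypothesis on `d` (none is
needed: both representations are given). The source slab is `ℚ`-semialgebraic by the crux's landed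
`PiBox.Dlog.isSemialgebraic_setOf_apply_mem_Ioo_of_isAlgebraic` (`…NormalFormPrincipleAlgDlogMoves.lean`);
the degenerate slab `a = b` is two null domains (`KZ.of_mem_relations_of_volume_eq_zero`).

References: M. Kontsevich, D. Zagier, *Periods* (2001), §1.2 rule (2). No definitions are introduced.
-/

noncomputable section

open MeasureTheory Set
open Literature.NumberTheory.Transcendental Literature.NumberTheory.Transcendental.KZ
open Literature.ModelTheory.ExponentialFields (IsSemialgebraic)

namespace Summit.KontsevichZagierPeriods.HurwitzMicroSectors.NormalFormPrinciple.AngARotateK3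

open Summit.KontsevichZagierPeriods.KontsevichZagierPeriods.BetaCancellationLine
  (moeb_image moeb_isSemialgebraicMapOn moeb_hasFDerivAt moeb_injOn moeb_abs_det moeb_pullback)
open Summit.KontsevichZagierPeriods.HurwitzMicroSectors.NormalFormPrinciple.PiBox.Dlog
  (isSemialgebraic_setOf_apply_mem_Ioo_of_isAlgebraic)

/-- The normalised rotation data of `σ`: with `r = √(1+σ²)`, `c = r⁻¹`, `s = −σ r⁻¹` one has
`c, s` real algebraic, `c² + s² = 1`, `M(t) = (ct − s)/(st + c) = (t + σ)/(1 − σt)` and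
`st + c = (1 − σt) r⁻¹`. [folklore] -/
theorem rotation_data {σ : ℝ} (hσ : IsAlgebraic ℚ σ) :
    ∃ r : ℝ, 0 < r ∧ IsAlgebraic ℚ r⁻¹ ∧ IsAlgebraic ℚ (-σ * r⁻¹) ∧
      r⁻¹ ^ 2 + (-σ * r⁻¹) ^ 2 = 1 ∧
      (∀ t : ℝ, (r⁻¹ * t - -σ * r⁻¹) / (-σ * r⁻¹ * t + r⁻¹) = (t + σ) / (1 - σ * t)) ∧
      ∀ t : ℝ, -σ * r⁻¹ * t + r⁻¹ = (1 - σ * t) * r⁻¹ := by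
  set r : ℝ := Real.sqrt (1 + σ ^ 2)
  have hr0 : 0 < r := Real.sqrt_pos.2 (by positivity)
  have hr2 : r ^ 2 = 1 + σ ^ 2 := Real.sq_sqrt (by positivity)
  have hralg : IsAlgebraic ℚ r :=
    IsAlgebraic.of_pow two_pos (by rw [hr2]; exact isAlgebraic_one.add (hσ.pow 2))
  have hden : ∀ t : ℝ, -σ * r⁻¹ * t + r⁻¹ = (1 - σ * t) * r⁻¹ := fun t => by ring
  refine ⟨r, hr0, hralg.inv, hσ.neg.mul hralg.inv, ?_, fun t => ?_, hden⟩
  · rw [mul_pow, inv_pow, neg_sq, hr2]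
    field_simp
  · rw [hden t, show r⁻¹ * t - -σ * r⁻¹ = (t + σ) * r⁻¹ by ring]
    exact mul_div_mul_right _ _ (inv_ne_zero hr0.ne')

/-- **Registered sub-goal `angA_rotate_mem_relations`** (arctangent layer of `stub_boxRigidity`,
crux `NormalFormPrinciple`): the Möbius rotation `y ↦ (y + σ)/(1 − σy)` (real algebraic `σ`,
`1 − σy > 0` on `[a, b]`) is ONE rule-(2) move preserving `d·dy/(1+y²)`:
`[(a,b), d/(1+y²)] − [(Φ a, Φ b), d/(1+y²)] ∈ relations` for any two representations with these
domains and integrands. Assembled from the landed `BetaCancellationLine.moeb_*` lemmas with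
`c = 1/√(1+σ²)`, `s = −σ/√(1+σ²)`. [cite: KontsevichZagier2001, §1.2] -/
theorem angA_rotate_mem_relations {a b d σ : ℝ} (ha : IsAlgebraic ℚ a) (hb : IsAlgebraic ℚ b)
    (hσ : IsAlgebraic ℚ σ) (hab : a ≤ b) (hpos : ∀ y ∈ Set.Icc a b, 0 < 1 - σ * y)
    (L L' : IntegralRep 1) (hdL : L.domain = {x | x 0 ∈ Set.Ioo a b})
    (hdL' : L'.domain = {x | x 0 ∈ Set.Ioo ((a + σ) / (1 - σ * a)) ((b + σ) / (1 - σ * b))})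
    (hi : EqOn L.integrand (fun x => d / (1 + x 0 ^ 2)) L.domain)
    (hi' : EqOn L'.integrand (fun x => d / (1 + x 0 ^ 2)) L'.domain) :
    of L - of L' ∈ relations := by
  rcases hab.eq_or_lt with rfl | hlt
  · -- degenerate slab `a = b`: both domains are empty, so both generators are relations
    have h1 : of L ∈ relations := of_mem_relations_of_volume_eq_zero L (by rw [hdL]; simp)
    have h2 : of L' ∈ relations := of_mem_relations_of_volume_eq_zero L' (by rw [hdL']; simp)
    exact sub_mem h1 h2
  -- the rotation data `c = r⁻¹`, `s = -σ r⁻¹`, `r = √(1+σ²)`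
  obtain ⟨r, hr0, hc, hs, hcs, hM, hsc⟩ := rotation_data hσ
  -- the denominator `s t + c` is positive on `[a, b] ⊇ L.domain`
  have hdenI : ∀ t ∈ Set.Icc a b, 0 < -σ * r⁻¹ * t + r⁻¹ := fun t ht => by
    rw [hsc t]; exact mul_pos (hpos t ht) (inv_pos.2 hr0)
  have hden : ∀ x ∈ L.domain, 0 < -σ * r⁻¹ * x 0 + r⁻¹ := fun x hx =>
    hdenI (x 0) (Ioo_subset_Icc_self (by rw [hdL] at hx; exact hx))
  -- the source domain is `ℚ`-semialgebraic (algebraic ends)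
  have hdom : IsSemialgebraic ℚ L.domain :=
    hdL ▸ isSemialgebraic_setOf_apply_mem_Ioo_of_isAlgebraic ha hb 0
  -- the chart maps `L.domain` onto `L'.domain`
  have himage : L'.domain = (fun y : Fin 1 → ℝ => fun _ : Fin 1 =>
      (r⁻¹ * y 0 - -σ * r⁻¹) / (-σ * r⁻¹ * y 0 + r⁻¹)) '' L.domain := by
    rw [hdL, moeb_image hcs hlt hdenI, hM, hM, hdL']
  refine changeOfVariablesRel_subset_relations
    ⟨1, L, L', fun y : Fin 1 → ℝ => fun _ : Fin 1 => (r⁻¹ * y 0 - -σ * r⁻¹) / (-σ * r⁻¹ * y 0 + r⁻¹),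
      fun x => (1 / (-σ * r⁻¹ * x 0 + r⁻¹) ^ 2) • ContinuousLinearMap.id ℝ (Fin 1 → ℝ),
      moeb_isSemialgebraicMapOn hc hs hdom fun x hx => (hden x hx).ne',
      fun x hx => (moeb_hasFDerivAt hcs (hden x hx).ne').hasFDerivWithinAt,
      moeb_injOn hcs hden, himage, fun x hx => ?_, rfl⟩
  -- the pull-back identity on `L.domain`, Jacobian `|det Φ'| = 1/(s x₀ + c)²` included
  have hΦx : (fun y : Fin 1 → ℝ => fun _ : Fin 1 =>
      (r⁻¹ * y 0 - -σ * r⁻¹) / (-σ * r⁻¹ * y 0 + r⁻¹)) x ∈ L'.domain :=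
    himage ▸ mem_image_of_mem _ hx
  have e1 : L.integrand x = d / (1 + x 0 ^ 2) := hi hx
  have e2 : L'.integrand (fun _ : Fin 1 => (r⁻¹ * x 0 - -σ * r⁻¹) / (-σ * r⁻¹ * x 0 + r⁻¹)) =
      d / (1 + ((r⁻¹ * x 0 - -σ * r⁻¹) / (-σ * r⁻¹ * x 0 + r⁻¹)) ^ 2) := hi' hΦx
  have e3 : |((1 / (-σ * r⁻¹ * x 0 + r⁻¹) ^ 2) • ContinuousLinearMap.id ℝ (Fin 1 → ℝ)).det| =
      1 / (-σ * r⁻¹ * x 0 + r⁻¹) ^ 2 := moeb_abs_det (one_div_pos.2 (pow_pos (hden x hx) 2))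
  show L.integrand x =
    L'.integrand (fun _ : Fin 1 => (r⁻¹ * x 0 - -σ * r⁻¹) / (-σ * r⁻¹ * x 0 + r⁻¹)) *
      |((1 / (-σ * r⁻¹ * x 0 + r⁻¹) ^ 2) • ContinuousLinearMap.id ℝ (Fin 1 → ℝ)).det|
  rw [e1, e2, e3]
  exact (moeb_pullback hcs d (hden x hx).ne').symm

end Summit.KontsevichZagierPeriods.HurwitzMicroSectors.NormalFormPrinciple.AngARotateK3

end
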